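import Literature.Computability.Cryptography.ShorProofs
import Literature.Computability.Complexity.StackMachines
import Literature.Computability.Complexity.PairProjections
import Literature.Computability.Complexity.TautCertificates
import Literature.Computability.Cryptography.QuantumCircuitProofs
import Literature.Computability.Cryptography.QubitRegisterCliffordTProofs
import HarnessLib

/-!
# `FACT ∈ BQP`, decision from search: the classical post-processor as a stack register program

Family `PQC` (trunk `CryptoQuantFine`), companion of `Literature/Computability/Cryptography/Shor.lean`
and `ShorProofs.lean`, towards the named fact `Literature.Computability.Cryptography.FACT_mem_BQP` (`FACT ∈ BQP`, Shor 1997, §5,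
decision form). `ShorProofs.FACT_mem_BQP_of` reduces `FACT ∈ BQP` to Shor's factoring theorem in
FBQP form (`isQSolvable_factoring`), the closure of bounded-error quantum search under classical
polynomial-time pre- and post-processing (`isQSolvable_classicalWrap`), the unitarity facts of the
circuit model (now discharged in the tree: `QCircuit.outputPMF_apply_holds`,
`cliffordT_isUnitary_holds`) and two *programming facts*: the pre- and post-processors of the
decision version are in `FP`. This file **discharges the programming facts** and re-assembles:

* the pre-processor is the first projection of the pair `⟨N, k⟩` (`boolUnpairFst_mem_FP` of
  `PairProjections.lean`); Shor's family is then run on the (possibly non-canonical) numeral of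
  `N`, whose factor list it delivers by the very statement of `isQSolvable_factoring`;
* the post-processor is a program `FactPost.prog` for the stack register machines of
  `StackMachines.lean` (`63` instructions, `4` binary stack registers), whose clocked run
  `FactPost.postFn` is in `FP` by `SProg.outputFn_mem_FP` (`FactPost.postFn_mem_FP`), and whose
  semantics is proved by symbolic execution (`FactPost.postFn_spec`): on `⟨x, y⟩` with `y`
  extending the code of the prime factor list of the first component of `x`, it outputs the
  membership bit `[x ∈ FACT]` (`ShorProofs.factBit`). The program parses the doubly-doubled bits of
  `x = ⟨a, b⟩` inside `⟨x, y⟩` (rejecting every `x` that is not a pair of canonical numerals —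
  `FACT` is the image of the canonical pair encoding), distinguishes `N = 0` (answer `2 ≤ k`, read
  off the top two bits of `b` reversed) from `N ≥ 1` (answer: the least prime factor `p₁` is
  `≤ k`; the factor list is sorted, `head_le_of_mem_primeFactorsList`), skips the unary length
  header of the list code, and compares the numerals of `p₁` and `k` least significant bit first
  with a three-state automaton (`FactPost.cmpRes`, `FactPost.cmpRes_encodePosNum`);
* `FACT_mem_BQP_of_wrap : isQSolvable_classicalWrap → isQSolvable_factoring → FACT_mem_BQP`.

## References

* P. W. Shor, *Polynomial-time algorithms for prime factorization and discrete logarithms on a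
  quantum computer*, SIAM J. Comput. 26 (1997) 1484–1509, §5 [Shor1997] (the theorem assembled).
* S. Arora, B. Barak, *Computational Complexity: A Modern Approach*, CUP 2009, Example 2.3
  (search vs decision for factoring), §0.1 (pairing of strings), §1.3–1.4 (robustness of
  polynomial time) [AroraBarak2009].
* M. L. Minsky, *Computation: Finite and Infinite Machines*, Prentice-Hall 1967, §11.1, §14.1
  (program machines with binary stack registers; the model of `StackMachines.lean`).

## Mathlib / tree

From Mathlib: `Computability.encodeNat`/`decodeNat` (binary numerals, least significant bit
first, positive numerals end in `true`; `encodePosNum`, `decodePosNum`, `PosNum.cast_bit0/1`,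
`Num.to_of_nat`, `PosNum.of_to_nat`), `Nat.primeFactorsList` (`primeFactorsList_add_two`,
`mem_primeFactorsList`, `Nat.minFac_le_of_dvd`), `List.twoStepInduction`, `Function.iterate_add_apply`.
From the tree: `SProg`, `SProg.step`, `SProg.init`, `SProg.dbl`, `SProg.outputFn_mem_FP`
(`StackMachines`), `boolPair`/`boolUnpair`, `Encoding.listBool`, `bitsToNat`, `bitsToNat_encodeNat`,
`bitsToNat_append` (`BoolEncodings`), `IsCanonicalNum`, `isCanonicalNum_encodeNat`,
`encodeNat_decodeNat` (`TautCertificates`),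
`boolUnpairFst_mem_FP` (`PairProjections`), `factBit`, `factAnswer`, `factBit_eq_true_iff`,
`IsQSolvable.mono`, `mem_BQP_of_isQSolvable_bit` (`ShorProofs`).

## Design notes

* Configurations are written `FactPost.C pc o k₁ k₂ i` with named register contents; one machine
  step is computed by `simp` from the listing lemmas `FactPost.prog_n : prog[n]? = some _` (all
  `rfl`) and the register lemmas `R_*`, `update_R_*`; runs are exact iterates
  `prog.step^[t] c = c'` chained by `Function.iterate_add_apply`, and `FactPost.Halts c B v`
  packages "halts within `B` steps with output `[v]`". The run takes `≤ 4|z| + 18` steps; the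
  clock polynomial is `3n + 20`.
* The post-processor is *defined* as the machine's output function, so its behaviour off the
  promise (malformed `y`) needs no description; on the promise it is pinned down by `postFn_spec`.
  This replaces the concrete `ShorProofs.factPost`/`factPre` (whose `FP` membership stays a named
  fact, now unused on this route).
-/

namespace Literature.Computability.Cryptography

open _root_.Computability Complexity

namespace FactPost

/-! ### The program -/

/-- The post-processor as a stack register program on `4` registers (`0` = output,
`1` = `K₁`, `2` = `K₂`, `3` = input). Blocks: `0–13` read the quadrupled bits of the first
component `a` of the instance (pushed on `K₂`), the separator `0011`, and branch on the last
bit of `a` (`SEP`, `CLR`); `14–22` (`N = 0`) and `23–31` (`N ≥ 1`) read the doubled bits of the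
second component `b` (pushed on `K₁`) up to the separator `01` and inspect the top of `K₁`;
`32–36` reverse `K₁` onto `K₂`; `37–41` skip the unary length header of the factor list and
reject an empty list; `42–59` compare the first listed prime with `K₂` bit by bit (three copies:
low parts compare `<`, `=`, `>`); `60–61` accept, `62` rejects. [folklore] -/
def prog : SProg 4 := [
  .pop 3 1 6 62,  -- 0: P1
  .pop 3 2 62 62,  -- 1: P1_T
  .pop 3 3 62 62,  -- 2: P1_TT
  .pop 3 4 62 62,  -- 3: P1_TTT
  .push 2 true,  -- 4: P1_pT
  .goto 0,  -- 5
  .pop 3 62 7 62,  -- 6: P1_F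
  .pop 3 11 8 62,  -- 7: P1_FF
  .pop 3 62 9 62,  -- 8: P1_FFF
  .push 2 false,  -- 9: P1_pF
  .goto 0,  -- 10
  .pop 3 12 62 62,  -- 11: P1_FFT
  .pop 2 13 62 14,  -- 12: SEP
  .pop 2 13 13 23,  -- 13: CLR
  .pop 3 15 18 62,  -- 14: A0
  .pop 3 16 62 62,  -- 15: A0_T
  .push 1 true,  -- 16: A0_pT
  .goto 14,  -- 17
  .pop 3 21 19 62,  -- 18: A0_F
  .push 1 false,  -- 19: A0_pF
  .goto 14,  -- 20
  .pop 1 22 62 62,  -- 21: A0_end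
  .pop 1 60 60 62,  -- 22: A0_end2
  .pop 3 24 27 62,  -- 23: A1
  .pop 3 25 62 62,  -- 24: A1_T
  .push 1 true,  -- 25: A1_pT
  .goto 23,  -- 26
  .pop 3 30 28 62,  -- 27: A1_F
  .push 1 false,  -- 28: A1_pF
  .goto 23,  -- 29
  .pop 1 31 62 62,  -- 30: A1_end
  .push 1 true,  -- 31: A1_back
  .pop 1 33 35 37,  -- 32: REV
  .push 2 true,  -- 33: REV_pT
  .goto 32,  -- 34
  .push 2 false,  -- 35: REV_pF
  .goto 32,  -- 36
  .pop 3 38 62 62,  -- 37: Y0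
  .pop 3 39 62 62,  -- 38: Y0_T
  .pop 3 40 41 62,  -- 39: Y1
  .pop 3 39 62 62,  -- 40: Y1_T
  .pop 3 48 62 62,  -- 41: Y1_F
  .pop 3 43 45 62,  -- 42: Clt
  .pop 3 44 62 62,  -- 43: Clt_T
  .pop 2 42 54 62,  -- 44: Clt_pT
  .pop 3 47 46 62,  -- 45: Clt_F
  .pop 2 42 42 62,  -- 46: Clt_pF
  .pop 2 60 60 60,  -- 47: Clt_end
  .pop 3 49 51 62,  -- 48: Ceq
  .pop 3 50 62 62,  -- 49: Ceq_T
  .pop 2 48 54 62,  -- 50: Ceq_pT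
  .pop 3 53 52 62,  -- 51: Ceq_F
  .pop 2 42 48 62,  -- 52: Ceq_pF
  .pop 2 60 60 60,  -- 53: Ceq_end
  .pop 3 55 57 62,  -- 54: Cgt
  .pop 3 56 62 62,  -- 55: Cgt_T
  .pop 2 54 54 62,  -- 56: Cgt_pT
  .pop 3 59 58 62,  -- 57: Cgt_F
  .pop 2 42 54 62,  -- 58: Cgt_pF
  .pop 2 60 60 62,  -- 59: Cgt_end
  .push 0 true,  -- 60: ACC
  .goto 63,  -- 61
  .push 0 false]  -- 62: REJ


section Listing

/-- Instruction `0` of `prog` (listing lemma for symbolic execution). [folklore] -/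
@[simp] theorem prog_0 : prog[0]? = some (.pop 3 1 6 62) := rfl
/-- Instruction `1` of `prog` (listing lemma for symbolic execution). [folklore] -/
@[simp] theorem prog_1 : prog[1]? = some (.pop 3 2 62 62) := rfl
/-- Instruction `2` of `prog` (listing lemma for symbolic execution). [folklore] -/
@[simp] theorem prog_2 : prog[2]? = some (.pop 3 3 62 62) := rfl
/-- Instruction `3` of `prog` (listing lemma for symbolic execution). [folklore] -/
@[simp] theorem prog_3 : prog[3]? = some (.pop 3 4 62 62) := rfl
/-- Instruction `4` of `prog` (listing lemma for symbolic execution). [folklore] -/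
@[simp] theorem prog_4 : prog[4]? = some (.push 2 true) := rfl
/-- Instruction `5` of `prog` (listing lemma for symbolic execution). [folklore] -/
@[simp] theorem prog_5 : prog[5]? = some (.goto 0) := rfl
/-- Instruction `6` of `prog` (listing lemma for symbolic execution). [folklore] -/
@[simp] theorem prog_6 : prog[6]? = some (.pop 3 62 7 62) := rfl
/-- Instruction `7` of `prog` (listing lemma for symbolic execution). [folklore] -/
@[simp] theorem prog_7 : prog[7]? = some (.pop 3 11 8 62) := rfl
/-- Instruction `8` of `prog` (listing lemma for symbolic execution). [folklore] -/
@[simp] theorem prog_8 : prog[8]? = some (.pop 3 62 9 62) := rfl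
/-- Instruction `9` of `prog` (listing lemma for symbolic execution). [folklore] -/
@[simp] theorem prog_9 : prog[9]? = some (.push 2 false) := rfl
/-- Instruction `10` of `prog` (listing lemma for symbolic execution). [folklore] -/
@[simp] theorem prog_10 : prog[10]? = some (.goto 0) := rfl
/-- Instruction `11` of `prog` (listing lemma for symbolic execution). [folklore] -/
@[simp] theorem prog_11 : prog[11]? = some (.pop 3 12 62 62) := rfl
/-- Instruction `12` of `prog` (listing lemma for symbolic execution). [folklore] -/
@[simp] theorem prog_12 : prog[12]? = some (.pop 2 13 62 14) := rfl
/-- Instruction `13` of `prog` (listing lemma for symbolic execution). [folklore] -/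
@[simp] theorem prog_13 : prog[13]? = some (.pop 2 13 13 23) := rfl
/-- Instruction `14` of `prog` (listing lemma for symbolic execution). [folklore] -/
@[simp] theorem prog_14 : prog[14]? = some (.pop 3 15 18 62) := rfl
/-- Instruction `15` of `prog` (listing lemma for symbolic execution). [folklore] -/
@[simp] theorem prog_15 : prog[15]? = some (.pop 3 16 62 62) := rfl
/-- Instruction `16` of `prog` (listing lemma for symbolic execution). [folklore] -/
@[simp] theorem prog_16 : prog[16]? = some (.push 1 true) := rfl
/-- Instruction `17` of `prog` (listing lemma for symbolic execution). [folklore] -/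
@[simp] theorem prog_17 : prog[17]? = some (.goto 14) := rfl
/-- Instruction `18` of `prog` (listing lemma for symbolic execution). [folklore] -/
@[simp] theorem prog_18 : prog[18]? = some (.pop 3 21 19 62) := rfl
/-- Instruction `19` of `prog` (listing lemma for symbolic execution). [folklore] -/
@[simp] theorem prog_19 : prog[19]? = some (.push 1 false) := rfl
/-- Instruction `20` of `prog` (listing lemma for symbolic execution). [folklore] -/
@[simp] theorem prog_20 : prog[20]? = some (.goto 14) := rfl
/-- Instruction `21` of `prog` (listing lemma for symbolic execution). [folklore] -/
@[simp] theorem prog_21 : prog[21]? = some (.pop 1 22 62 62) := rfl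
/-- Instruction `22` of `prog` (listing lemma for symbolic execution). [folklore] -/
@[simp] theorem prog_22 : prog[22]? = some (.pop 1 60 60 62) := rfl
/-- Instruction `23` of `prog` (listing lemma for symbolic execution). [folklore] -/
@[simp] theorem prog_23 : prog[23]? = some (.pop 3 24 27 62) := rfl
/-- Instruction `24` of `prog` (listing lemma for symbolic execution). [folklore] -/
@[simp] theorem prog_24 : prog[24]? = some (.pop 3 25 62 62) := rfl
/-- Instruction `25` of `prog` (listing lemma for symbolic execution). [folklore] -/
@[simp] theorem prog_25 : prog[25]? = some (.push 1 true) := rfl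
/-- Instruction `26` of `prog` (listing lemma for symbolic execution). [folklore] -/
@[simp] theorem prog_26 : prog[26]? = some (.goto 23) := rfl
/-- Instruction `27` of `prog` (listing lemma for symbolic execution). [folklore] -/
@[simp] theorem prog_27 : prog[27]? = some (.pop 3 30 28 62) := rfl
/-- Instruction `28` of `prog` (listing lemma for symbolic execution). [folklore] -/
@[simp] theorem prog_28 : prog[28]? = some (.push 1 false) := rfl
/-- Instruction `29` of `prog` (listing lemma for symbolic execution). [folklore] -/
@[simp] theorem prog_29 : prog[29]? = some (.goto 23) := rfl
/-- Instruction `30` of `prog` (listing lemma for symbolic execution). [folklore] -/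
@[simp] theorem prog_30 : prog[30]? = some (.pop 1 31 62 62) := rfl
/-- Instruction `31` of `prog` (listing lemma for symbolic execution). [folklore] -/
@[simp] theorem prog_31 : prog[31]? = some (.push 1 true) := rfl
/-- Instruction `32` of `prog` (listing lemma for symbolic execution). [folklore] -/
@[simp] theorem prog_32 : prog[32]? = some (.pop 1 33 35 37) := rfl
/-- Instruction `33` of `prog` (listing lemma for symbolic execution). [folklore] -/
@[simp] theorem prog_33 : prog[33]? = some (.push 2 true) := rfl
/-- Instruction `34` of `prog` (listing lemma for symbolic execution). [folklore] -/
@[simp] theorem prog_34 : prog[34]? = some (.goto 32) := rfl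
/-- Instruction `35` of `prog` (listing lemma for symbolic execution). [folklore] -/
@[simp] theorem prog_35 : prog[35]? = some (.push 2 false) := rfl
/-- Instruction `36` of `prog` (listing lemma for symbolic execution). [folklore] -/
@[simp] theorem prog_36 : prog[36]? = some (.goto 32) := rfl
/-- Instruction `37` of `prog` (listing lemma for symbolic execution). [folklore] -/
@[simp] theorem prog_37 : prog[37]? = some (.pop 3 38 62 62) := rfl
/-- Instruction `38` of `prog` (listing lemma for symbolic execution). [folklore] -/
@[simp] theorem prog_38 : prog[38]? = some (.pop 3 39 62 62) := rfl
/-- Instruction `39` of `prog` (listing lemma for symbolic execution). [folklore] -/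
@[simp] theorem prog_39 : prog[39]? = some (.pop 3 40 41 62) := rfl
/-- Instruction `40` of `prog` (listing lemma for symbolic execution). [folklore] -/
@[simp] theorem prog_40 : prog[40]? = some (.pop 3 39 62 62) := rfl
/-- Instruction `41` of `prog` (listing lemma for symbolic execution). [folklore] -/
@[simp] theorem prog_41 : prog[41]? = some (.pop 3 48 62 62) := rfl
/-- Instruction `42` of `prog` (listing lemma for symbolic execution). [folklore] -/
@[simp] theorem prog_42 : prog[42]? = some (.pop 3 43 45 62) := rfl
/-- Instruction `43` of `prog` (listing lemma for symbolic execution). [folklore] -/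
@[simp] theorem prog_43 : prog[43]? = some (.pop 3 44 62 62) := rfl
/-- Instruction `44` of `prog` (listing lemma for symbolic execution). [folklore] -/
@[simp] theorem prog_44 : prog[44]? = some (.pop 2 42 54 62) := rfl
/-- Instruction `45` of `prog` (listing lemma for symbolic execution). [folklore] -/
@[simp] theorem prog_45 : prog[45]? = some (.pop 3 47 46 62) := rfl
/-- Instruction `46` of `prog` (listing lemma for symbolic execution). [folklore] -/
@[simp] theorem prog_46 : prog[46]? = some (.pop 2 42 42 62) := rfl
/-- Instruction `47` of `prog` (listing lemma for symbolic execution). [folklore] -/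
@[simp] theorem prog_47 : prog[47]? = some (.pop 2 60 60 60) := rfl
/-- Instruction `48` of `prog` (listing lemma for symbolic execution). [folklore] -/
@[simp] theorem prog_48 : prog[48]? = some (.pop 3 49 51 62) := rfl
/-- Instruction `49` of `prog` (listing lemma for symbolic execution). [folklore] -/
@[simp] theorem prog_49 : prog[49]? = some (.pop 3 50 62 62) := rfl
/-- Instruction `50` of `prog` (listing lemma for symbolic execution). [folklore] -/
@[simp] theorem prog_50 : prog[50]? = some (.pop 2 48 54 62) := rfl
/-- Instruction `51` of `prog` (listing lemma for symbolic execution). [folklore] -/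
@[simp] theorem prog_51 : prog[51]? = some (.pop 3 53 52 62) := rfl
/-- Instruction `52` of `prog` (listing lemma for symbolic execution). [folklore] -/
@[simp] theorem prog_52 : prog[52]? = some (.pop 2 42 48 62) := rfl
/-- Instruction `53` of `prog` (listing lemma for symbolic execution). [folklore] -/
@[simp] theorem prog_53 : prog[53]? = some (.pop 2 60 60 60) := rfl
/-- Instruction `54` of `prog` (listing lemma for symbolic execution). [folklore] -/
@[simp] theorem prog_54 : prog[54]? = some (.pop 3 55 57 62) := rfl
/-- Instruction `55` of `prog` (listing lemma for symbolic execution). [folklore] -/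
@[simp] theorem prog_55 : prog[55]? = some (.pop 3 56 62 62) := rfl
/-- Instruction `56` of `prog` (listing lemma for symbolic execution). [folklore] -/
@[simp] theorem prog_56 : prog[56]? = some (.pop 2 54 54 62) := rfl
/-- Instruction `57` of `prog` (listing lemma for symbolic execution). [folklore] -/
@[simp] theorem prog_57 : prog[57]? = some (.pop 3 59 58 62) := rfl
/-- Instruction `58` of `prog` (listing lemma for symbolic execution). [folklore] -/
@[simp] theorem prog_58 : prog[58]? = some (.pop 2 42 54 62) := rfl
/-- Instruction `59` of `prog` (listing lemma for symbolic execution). [folklore] -/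
@[simp] theorem prog_59 : prog[59]? = some (.pop 2 60 60 62) := rfl
/-- Instruction `60` of `prog` (listing lemma for symbolic execution). [folklore] -/
@[simp] theorem prog_60 : prog[60]? = some (.push 0 true) := rfl
/-- Instruction `61` of `prog` (listing lemma for symbolic execution). [folklore] -/
@[simp] theorem prog_61 : prog[61]? = some (.goto 63) := rfl
/-- Instruction `62` of `prog` (listing lemma for symbolic execution). [folklore] -/
@[simp] theorem prog_62 : prog[62]? = some (.push 0 false) := rfl
/-- Instruction `63` of `prog` (listing lemma for symbolic execution). [folklore] -/
@[simp] theorem prog_63 : prog[63]? = none := rfl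
/-- `prog` has `63` instructions (so program counter `63` means: halted). [folklore] -/
theorem prog_length : prog.length = 63 := rfl

end Listing

/-! ### Configurations with named registers -/

/-- Register file with contents `o` (output), `a` (`K₁`), `b` (`K₂`), `i` (input). [folklore] -/
def R (o a b i : List Bool) : Fin 4 → List Bool := ![o, a, b, i]

/-- The configuration with program counter `pc` and registers `o, a, b, i`. [folklore] -/
def C (pc : ℕ) (o a b i : List Bool) : SCfg 4 := ⟨pc, R o a b i⟩

/-- Register `0` (output). [folklore] -/
@[simp] theorem R_zero (o a b i : List Bool) : R o a b i 0 = o := rfl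
/-- Register `1` (`K₁`). [folklore] -/
@[simp] theorem R_one (o a b i : List Bool) : R o a b i 1 = a := rfl
/-- Register `2` (`K₂`). [folklore] -/
@[simp] theorem R_two (o a b i : List Bool) : R o a b i 2 = b := rfl
/-- Register `3` (input). [folklore] -/
@[simp] theorem R_three (o a b i : List Bool) : R o a b i 3 = i := rfl
/-- Writing register `0`. [folklore] -/
@[simp] theorem update_R_zero (o a b i v : List Bool) :
    Function.update (R o a b i) 0 v = R v a b i := by
  funext j; fin_cases j <;> rfl
/-- Writing register `1`. [folklore] -/
@[simp] theorem update_R_one (o a b i v : List Bool) :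
    Function.update (R o a b i) 1 v = R o v b i := by
  funext j; fin_cases j <;> rfl
/-- Writing register `2`. [folklore] -/
@[simp] theorem update_R_two (o a b i v : List Bool) :
    Function.update (R o a b i) 2 v = R o a v i := by
  funext j; fin_cases j <;> rfl
/-- Writing register `3`. [folklore] -/
@[simp] theorem update_R_three (o a b i v : List Bool) :
    Function.update (R o a b i) 3 v = R o a b v := by
  funext j; fin_cases j <;> rfl
/-- The program counter of `C`. [folklore] -/
@[simp] theorem C_pc (pc : ℕ) (o a b i : List Bool) : (C pc o a b i).pc = pc := rfl
/-- The registers of `C`. [folklore] -/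
@[simp] theorem C_regs (pc : ℕ) (o a b i : List Bool) : (C pc o a b i).regs = R o a b i := rfl

/-- The initial configuration on input `z`. [folklore] -/
theorem init_eq (z : List Bool) : (SProg.init z : SCfg 4) = C 0 [] [] [] z := by
  simp only [SProg.init, C]
  congr 1
  funext j; fin_cases j <;> rfl

/-- The halted configuration is fixed. [folklore] -/
theorem run_halt (t : ℕ) (o a b i : List Bool) : prog.step^[t] (C 63 o a b i) = C 63 o a b i :=
  prog.iterate_step_of_le (by simp [prog_length]) t

/-- Rejecting: push `false` on the output register and halt. [folklore] -/
theorem run_rej (o a b i : List Bool) : prog.step^[1] (C 62 o a b i) = C 63 (false :: o) a b i := by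
  simp [SProg.step, C]

/-- Accepting: push `true` on the output register and halt. [folklore] -/
theorem run_acc (o a b i : List Bool) : prog.step^[2] (C 60 o a b i) = C 63 (true :: o) a b i := by
  simp [Function.iterate_succ_apply, SProg.step, C]

/-- The final address reached with verdict `v`. [folklore] -/
def fin (v : Bool) : ℕ := if v then 60 else 62

/-- From the final address the machine halts with the verdict on top of the output register.
[folklore] -/
theorem run_fin (v : Bool) (o a b i : List Bool) :
    ∃ t ≤ 2, prog.step^[t] (C (fin v) o a b i) = C 63 (v :: o) a b i := by
  cases v
  · exact ⟨1, by norm_num, run_rej o a b i⟩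
  · exact ⟨2, le_rfl, run_acc o a b i⟩

/-! ### Phase 1: the first component of the instance -/

/-- One quadrupled bit of `a`: four pops and a push on `K₂`. [folklore] -/
theorem run_quad (c : Bool) (o k₁ k₂ rest : List Bool) :
    prog.step^[6] (C 0 o k₁ k₂ (c :: c :: c :: c :: rest)) = C 0 o k₁ (c :: k₂) rest := by
  cases c <;> simp [Function.iterate_succ_apply, SProg.step, C]

/-- Reading all of `a`: `K₂` receives `a` reversed. [folklore] -/
theorem run_quads (a : List Bool) (o k₁ k₂ rest : List Bool) :
    prog.step^[6 * a.length] (C 0 o k₁ k₂ (SProg.dbl (SProg.dbl a) ++ rest)) =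
      C 0 o k₁ (a.reverse ++ k₂) rest := by
  induction a generalizing k₂ with
  | nil => rfl
  | cons c a ih =>
    rw [show 6 * (c :: a).length = 6 * a.length + 6 by simp [Nat.mul_succ],
      Function.iterate_add_apply]
    simp only [SProg.dbl_cons, List.cons_append]
    rw [run_quad, ih]
    simp

/-- The separator `0011` after an empty `a`: on to block `A0` (`N = 0`). [folklore] -/
theorem run_sep_nil (o k₁ rest : List Bool) :
    prog.step^[5] (C 0 o k₁ [] (false :: false :: true :: true :: rest)) = C 14 o k₁ [] rest := by
  simp [Function.iterate_succ_apply, SProg.step, C]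

/-- The separator after an `a` ending in `0` (a non-canonical numeral): reject. [folklore] -/
theorem run_sep_false (o k₁ ar rest : List Bool) :
    prog.step^[5] (C 0 o k₁ (false :: ar) (false :: false :: true :: true :: rest)) =
      C 62 o k₁ ar rest := by
  simp [Function.iterate_succ_apply, SProg.step, C]

/-- The separator after an `a` ending in `1`: on to clearing `K₂`. [folklore] -/
theorem run_sep_true (o k₁ ar rest : List Bool) :
    prog.step^[5] (C 0 o k₁ (true :: ar) (false :: false :: true :: true :: rest)) =
      C 13 o k₁ ar rest := by
  simp [Function.iterate_succ_apply, SProg.step, C]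

/-- Clearing `K₂`, then on to block `A1` (`N ≥ 1`). [folklore] -/
theorem run_clr (l : List Bool) (o k₁ i : List Bool) :
    prog.step^[l.length + 1] (C 13 o k₁ l i) = C 23 o k₁ [] i := by
  induction l with
  | nil => simp [SProg.step, C]
  | cons c l ih =>
    rw [List.length_cons, Function.iterate_add_apply]
    have : prog.step^[1] (C 13 o k₁ (c :: l) i) = C 13 o k₁ l i := by
      cases c <;> simp [SProg.step, C]
    rw [this, ih]

/-- Malformed instance, tail `[1]` or `10…`: reject. [folklore] -/
theorem run_bad_tt (o k₁ k₂ rest : List Bool) :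
    prog.step^[3] (C 0 o k₁ k₂ (true :: true :: false :: rest)) = C 62 o k₁ k₂ rest := by
  simp [Function.iterate_succ_apply, SProg.step, C]

/-- Malformed instance, tail `[0]`: reject. [folklore] -/
theorem run_bad_f (o k₁ k₂ rest : List Bool) :
    prog.step^[4] (C 0 o k₁ k₂ (false :: false :: false :: true :: rest)) = C 62 o k₁ k₂ rest := by
  simp [Function.iterate_succ_apply, SProg.step, C]

/-- Malformed instance, no separator: reject. [folklore] -/
theorem run_bad_nil (o k₁ k₂ rest : List Bool) :
    prog.step^[2] (C 0 o k₁ k₂ (false :: true :: rest)) = C 62 o k₁ k₂ rest := by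
  simp [Function.iterate_succ_apply, SProg.step, C]

/-! ### Phase 2: the second component of the instance -/

/-- One doubled bit of `b` in block `A0`: two pops and a push on `K₁`. [folklore] -/
theorem run_pairA0 (c : Bool) (o k₁ k₂ rest : List Bool) :
    prog.step^[4] (C 14 o k₁ k₂ (c :: c :: rest)) = C 14 o (c :: k₁) k₂ rest := by
  cases c <;> simp [Function.iterate_succ_apply, SProg.step, C]

/-- One doubled bit of `b` in block `A1`. [folklore] -/
theorem run_pairA1 (c : Bool) (o k₁ k₂ rest : List Bool) :
    prog.step^[4] (C 23 o k₁ k₂ (c :: c :: rest)) = C 23 o (c :: k₁) k₂ rest := by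
  cases c <;> simp [Function.iterate_succ_apply, SProg.step, C]

/-- Reading all of `b` in block `A0`: `K₁` receives `b` reversed. [folklore] -/
theorem run_pairsA0 (b : List Bool) (o k₁ k₂ rest : List Bool) :
    prog.step^[4 * b.length] (C 14 o k₁ k₂ (SProg.dbl b ++ rest)) =
      C 14 o (b.reverse ++ k₁) k₂ rest := by
  induction b generalizing k₁ with
  | nil => rfl
  | cons c b ih =>
    rw [show 4 * (c :: b).length = 4 * b.length + 4 by simp [Nat.mul_succ],
      Function.iterate_add_apply]
    simp only [SProg.dbl_cons, List.cons_append]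
    rw [run_pairA0, ih]
    simp

/-- Reading all of `b` in block `A1`. [folklore] -/
theorem run_pairsA1 (b : List Bool) (o k₁ k₂ rest : List Bool) :
    prog.step^[4 * b.length] (C 23 o k₁ k₂ (SProg.dbl b ++ rest)) =
      C 23 o (b.reverse ++ k₁) k₂ rest := by
  induction b generalizing k₁ with
  | nil => rfl
  | cons c b ih =>
    rw [show 4 * (c :: b).length = 4 * b.length + 4 by simp [Nat.mul_succ],
      Function.iterate_add_apply]
    simp only [SProg.dbl_cons, List.cons_append]
    rw [run_pairA1, ih]
    simp

/-- The separator `01` ending the instance, block `A0`. [folklore] -/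
theorem run_endA0 (o k₁ k₂ rest : List Bool) :
    prog.step^[2] (C 14 o k₁ k₂ (false :: true :: rest)) = C 21 o k₁ k₂ rest := by
  simp [Function.iterate_succ_apply, SProg.step, C]

/-- The separator `01` ending the instance, block `A1`. [folklore] -/
theorem run_endA1 (o k₁ k₂ rest : List Bool) :
    prog.step^[2] (C 23 o k₁ k₂ (false :: true :: rest)) = C 30 o k₁ k₂ rest := by
  simp [Function.iterate_succ_apply, SProg.step, C]

/-- `N = 0`: accept iff `K₁ = b.reverse` starts `1, d` (i.e. `|b| ≥ 2` with last bit `1`,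
`k ≥ 2`). [folklore] -/
theorem run_testA0 (o k₁ k₂ i : List Bool) :
    ∃ t ≤ 2, ∃ k₁', prog.step^[t] (C 21 o k₁ k₂ i) =
      C (fin (match k₁ with | true :: _ :: _ => true | _ => false)) o k₁' k₂ i := by
  rcases k₁ with _ | ⟨c, _ | ⟨d, l⟩⟩
  · exact ⟨1, by norm_num, [], by simp [SProg.step, C, fin]⟩
  · cases c
    · exact ⟨1, by norm_num, [], by simp [SProg.step, C, fin]⟩
    · exact ⟨2, le_rfl, [], by simp [Function.iterate_succ_apply, SProg.step, C, fin]⟩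
  · cases c
    · exact ⟨1, by norm_num, d :: l, by simp [SProg.step, C, fin]⟩
    · refine ⟨2, le_rfl, l, ?_⟩
      cases d <;> simp [Function.iterate_succ_apply, SProg.step, C, fin]

/-- `N ≥ 1`, `K₁ = b.reverse` empty (`k = 0`) or starting with `0` (non-canonical): reject.
[folklore] -/
theorem run_testA1_rej (o k₂ i : List Bool) (k₁ : List Bool) (h : ∀ l, k₁ ≠ true :: l) :
    ∃ k₁', prog.step^[1] (C 30 o k₁ k₂ i) = C 62 o k₁' k₂ i := by
  rcases k₁ with _ | ⟨c, l⟩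
  · exact ⟨[], by simp [SProg.step, C]⟩
  · cases c
    · exact ⟨l, by simp [SProg.step, C]⟩
    · exact absurd rfl (h l)

/-- `N ≥ 1`, `K₁` starting with `1`: put the bit back and go to the reversal. [folklore] -/
theorem run_testA1 (o l k₂ i : List Bool) :
    prog.step^[2] (C 30 o (true :: l) k₂ i) = C 32 o (true :: l) k₂ i := by
  simp [Function.iterate_succ_apply, SProg.step, C]

/-- Reversal of `K₁` onto `K₂`. [folklore] -/
theorem run_rev (l : List Bool) (o k₂ i : List Bool) :
    prog.step^[3 * l.length + 1] (C 32 o l k₂ i) = C 37 o [] (l.reverse ++ k₂) i := by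
  induction l generalizing k₂ with
  | nil => simp [SProg.step, C]
  | cons c l ih =>
    rw [show 3 * (c :: l).length + 1 = (3 * l.length + 1) + 3 by simp only [List.length_cons]; ring,
      Function.iterate_add_apply]
    have : prog.step^[3] (C 32 o (c :: l) k₂ i) = C 32 o l (c :: k₂) i := by
      cases c <;> simp [Function.iterate_succ_apply, SProg.step, C]
    rw [this, ih]
    simp

/-! ### Phase 3: the factor list -/

/-- Empty factor list (header `01`): reject. [folklore] -/
theorem run_hdr_nil (o k₁ k₂ rest : List Bool) :
    prog.step^[1] (C 37 o k₁ k₂ (false :: rest)) = C 62 o k₁ k₂ rest := by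
  simp [SProg.step, C]

/-- First unary digit of a nonempty list length. [folklore] -/
theorem run_hdr_first (o k₁ k₂ rest : List Bool) :
    prog.step^[2] (C 37 o k₁ k₂ (true :: true :: rest)) = C 39 o k₁ k₂ rest := by
  simp [Function.iterate_succ_apply, SProg.step, C]

/-- The remaining unary digits. [folklore] -/
theorem run_hdr_rest (m : ℕ) (o k₁ k₂ rest : List Bool) :
    prog.step^[2 * m] (C 39 o k₁ k₂ (SProg.dbl (List.replicate m true) ++ rest)) =
      C 39 o k₁ k₂ rest := by
  induction m with
  | zero => rfl
  | succ m ih =>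
    rw [show 2 * (m + 1) = 2 * m + 2 by ring, Function.iterate_add_apply]
    simp only [List.replicate_succ, SProg.dbl_cons, List.cons_append]
    have : prog.step^[2] (C 39 o k₁ k₂ (true :: true :: (SProg.dbl (List.replicate m true) ++
        rest))) = C 39 o k₁ k₂ (SProg.dbl (List.replicate m true) ++ rest) := by
      simp [Function.iterate_succ_apply, SProg.step, C]
    rw [this, ih]

/-- End of the header: on to the comparison, low parts equal. [folklore] -/
theorem run_hdr_end (o k₁ k₂ rest : List Bool) :
    prog.step^[2] (C 39 o k₁ k₂ (false :: true :: rest)) = C 48 o k₁ k₂ rest := by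
  simp [Function.iterate_succ_apply, SProg.step, C]

/-! ### The comparison `p ≤ k` -/

/-- Comparison states: how the low-order parts read so far compare. [folklore] -/
inductive CSt
  | lt | eq | gt
  deriving DecidableEq

/-- Block addresses of the comparison states. [folklore] -/
def cm : CSt → ℕ
  | .lt => 42
  | .eq => 48
  | .gt => 54

/-- State update on reading bit `c` of `p` and bit `e` of `k` (higher bits dominate).
[folklore] -/
def upd (s : CSt) (c e : Bool) : CSt :=
  if c = e then s else if c then .gt else .lt

/-- The verdict of the comparison loop on the remaining bits `p` (input, doubled) and `kb`
(`K₂`): `p` exhausted — accept unless `kb` is exhausted too and the state is `gt`;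
`kb` exhausted first — reject. [folklore] -/
def cmpRes : CSt → List Bool → List Bool → Bool
  | s, [], [] => decide (s ≠ .gt)
  | _, [], _ :: _ => true
  | _, _ :: _, [] => false
  | s, c :: p, e :: kb => cmpRes (upd s c e) p kb

/-- One bit of `p` against one bit of `k`. [folklore] -/
theorem run_cmp_bit (s : CSt) (c e : Bool) (o k₁ kb rest : List Bool) :
    prog.step^[3] (C (cm s) o k₁ (e :: kb) (c :: c :: rest)) = C (cm (upd s c e)) o k₁ kb rest := by
  cases s <;> cases c <;> cases e <;> simp [Function.iterate_succ_apply, SProg.step, C, cm, upd]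

/-- One bit of `p` when `k` is exhausted: reject. [folklore] -/
theorem run_cmp_bit_nil (s : CSt) (c : Bool) (o k₁ rest : List Bool) :
    prog.step^[3] (C (cm s) o k₁ [] (c :: c :: rest)) = C 62 o k₁ [] rest := by
  cases s <;> cases c <;> simp [Function.iterate_succ_apply, SProg.step, C, cm]

/-- End of `p`: the verdict. [folklore] -/
theorem run_cmp_end (s : CSt) (o k₁ kb rest : List Bool) :
    ∃ kb', prog.step^[3] (C (cm s) o k₁ kb (false :: true :: rest)) =
      C (fin (cmpRes s [] kb)) o k₁ kb' rest := by
  rcases kb with _ | ⟨e, kb⟩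
  · exact ⟨[], by cases s <;> simp [Function.iterate_succ_apply, SProg.step, C, cm, cmpRes, fin]⟩
  · exact ⟨kb, by
      cases s <;> cases e <;> simp [Function.iterate_succ_apply, SProg.step, C, cm, cmpRes, fin]⟩

/-- The comparison loop computes `cmpRes`. [folklore] -/
theorem run_cmp (p : List Bool) (s : CSt) (o k₁ kb rest : List Bool) :
    ∃ t ≤ 3 * p.length + 3, ∃ kb' i', prog.step^[t] (C (cm s) o k₁ kb (SProg.dbl p ++ false :: true :: rest)) =
      C (fin (cmpRes s p kb)) o k₁ kb' i' := by
  induction p generalizing s kb with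
  | nil =>
    obtain ⟨kb', h⟩ := run_cmp_end s o k₁ kb rest
    exact ⟨3, by norm_num, kb', rest, by simpa using h⟩
  | cons c p ih =>
    rcases kb with _ | ⟨e, kb⟩
    · refine ⟨3, by simp, [], SProg.dbl p ++ false :: true :: rest, ?_⟩
      simp only [SProg.dbl_cons, List.cons_append]
      rw [run_cmp_bit_nil]
      rfl
    · obtain ⟨t, ht, kb', i', h⟩ := ih (upd s c e) kb
      refine ⟨t + 3, by simp [Nat.mul_succ]; omega, kb', i', ?_⟩
      rw [Function.iterate_add_apply]
      simp only [SProg.dbl_cons, List.cons_append]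
      rw [run_cmp_bit, h]
      rfl

/-! ### Binary numerals (Mathlib's `encodeNat`: least significant bit first, no trailing `0`) -/

/-- Bit strings ending in `1` are canonical numerals (`Literature.Computability.Complexity.IsCanonicalNum`,
`TautCertificates`), so `encodeNat ∘ decodeNat` fixes them: the `l ++ [true]` instance of
`Literature.Computability.Complexity.encodeNat_decodeNat`. [folklore] -/
theorem encodeNat_decodeNat_append_true (l : List Bool) :
    encodeNat (decodeNat (l ++ [true])) = l ++ [true] :=
  encodeNat_decodeNat (Or.inr (by simp))

/-- The value (`Literature.Computability.Complexity.bitsToNat`, `BoolEncodings`) of a bit string ending in `1` is its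
decoding. [folklore] -/
theorem bitsToNat_eq_decodeNat (l : List Bool) :
    bitsToNat (l ++ [true]) = decodeNat (l ++ [true]) := by
  conv_lhs => rw [← encodeNat_decodeNat_append_true l]
  exact bitsToNat_encodeNat _

/-- Lower bound for the value of a bit string ending in `1` (from `bitsToNat_append`).
[folklore] -/
theorem two_pow_le_bitsToNat (l : List Bool) : 2 ^ l.length ≤ bitsToNat (l ++ [true]) := by
  rw [bitsToNat_append]
  simp

/-- A positive number is coded by a `PosNum`. [folklore] -/
theorem exists_encodePosNum {n : ℕ} (hn : n ≠ 0) :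
    ∃ P : PosNum, encodeNat n = encodePosNum P ∧ (P : ℕ) = n := by
  have h := Num.to_of_nat n
  cases hν : (n : Num) with
  | zero => rw [hν] at h; exact absurd h.symm (by simpa using hn)
  | pos P =>
    rw [hν] at h
    exact ⟨P, by simp [encodeNat, hν, encodeNum], by simpa using h⟩

/-- No numeral ends in `0` (numerals are canonical, `Literature.Computability.Complexity.isCanonicalNum_encodeNat`,
`TautCertificates`). [folklore] -/
theorem encodeNat_ne_append_false (n : ℕ) (l : List Bool) : encodeNat n ≠ l ++ [false] := by
  intro h
  rcases isCanonicalNum_encodeNat n with h' | h' <;> rw [h] at h' <;> simp at h'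

/-! ### Correctness of the comparison -/

/-- With `p` exhausted and `k` not, accept. [folklore] -/
theorem cmpRes_nil_of_ne_nil (s : CSt) {kb : List Bool} (h : kb ≠ []) : cmpRes s [] kb = true := by
  rcases kb with _ | ⟨e, kb⟩
  · exact absurd rfl h
  · rfl

/-- With `k` exhausted and `p` not, reject. [folklore] -/
theorem cmpRes_cons_nil (s : CSt) (c : Bool) (p : List Bool) : cmpRes s (c :: p) [] = false := rfl

/-- **The comparison loop compares.** On positive numerals `P`, `K` and initial state `s`
(the comparison of the low-order parts already read), the verdict is
`P < K ∨ (P = K ∧ s ≠ gt)`. [folklore] -/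
theorem cmpRes_encodePosNum (s : CSt) (P K : PosNum) :
    cmpRes s (encodePosNum P) (encodePosNum K) =
      decide ((P : ℕ) < K ∨ ((P : ℕ) = K ∧ s ≠ .gt)) := by
  have hne : ∀ Q : PosNum, ∃ c l, encodePosNum Q = c :: l := fun Q => by
    rcases h : encodePosNum Q with _ | ⟨c, l⟩
    · exact absurd h (encodePosNum_nonempty Q)
    · exact ⟨c, l, rfl⟩
  induction P generalizing K s with
  | one =>
    cases K with
    | one =>
      cases s <;> simp [encodePosNum, cmpRes, upd]
    | bit1 K =>
      have hK := PosNum.cast_pos (α := ℕ) K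
      rw [encodePosNum, encodePosNum, cmpRes, upd, if_pos rfl,
        cmpRes_nil_of_ne_nil _ (encodePosNum_nonempty K)]
      symm; apply decide_eq_true; left
      simp only [PosNum.cast_one', PosNum.cast_bit1]; omega
    | bit0 K =>
      have hK := PosNum.cast_pos (α := ℕ) K
      rw [encodePosNum, encodePosNum, cmpRes, upd, if_neg (by decide), if_pos rfl,
        cmpRes_nil_of_ne_nil _ (encodePosNum_nonempty K)]
      symm; apply decide_eq_true; left
      simp only [PosNum.cast_one', PosNum.cast_bit0]; omega
  | bit1 P ih =>
    have hP := PosNum.cast_pos (α := ℕ) P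
    cases K with
    | one =>
      obtain ⟨c, l, hl⟩ := hne P
      rw [encodePosNum, encodePosNum, cmpRes, hl, cmpRes_cons_nil]
      symm; apply decide_eq_false
      simp only [PosNum.cast_one', PosNum.cast_bit1]; omega
    | bit1 K =>
      rw [encodePosNum, encodePosNum, cmpRes, upd, if_pos rfl, ih, decide_eq_decide]
      cases s <;> simp only [PosNum.cast_bit1, ne_eq, reduceCtorEq, not_false_eq_true, and_true,
        not_true_eq_false, and_false, or_false] <;> omega
    | bit0 K =>
      rw [encodePosNum, encodePosNum, cmpRes, upd, if_neg (by decide), if_pos rfl, ih,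
        decide_eq_decide]
      cases s <;> simp only [PosNum.cast_bit1, PosNum.cast_bit0, ne_eq, reduceCtorEq,
        not_false_eq_true, and_true, not_true_eq_false, and_false, or_false] <;> omega
  | bit0 P ih =>
    have hP := PosNum.cast_pos (α := ℕ) P
    cases K with
    | one =>
      obtain ⟨c, l, hl⟩ := hne P
      rw [encodePosNum, encodePosNum, cmpRes, hl, cmpRes_cons_nil]
      symm; apply decide_eq_false
      simp only [PosNum.cast_one', PosNum.cast_bit0]; omega
    | bit1 K =>
      rw [encodePosNum, encodePosNum, cmpRes, upd, if_neg (by decide), if_neg (by decide), ih,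
        decide_eq_decide]
      cases s <;> simp only [PosNum.cast_bit1, PosNum.cast_bit0, ne_eq, reduceCtorEq,
        not_false_eq_true, and_true, not_true_eq_false, and_false, or_false] <;> omega
    | bit0 K =>
      rw [encodePosNum, encodePosNum, cmpRes, upd, if_pos rfl, ih, decide_eq_decide]
      cases s <;> simp only [PosNum.cast_bit0, ne_eq, reduceCtorEq, not_false_eq_true, and_true,
        not_true_eq_false, and_false, or_false] <;> omega

/-- The comparison on numerals of positive numbers, from state `eq`: `p ≤ k`. [folklore] -/
theorem cmpRes_encodeNat {p k : ℕ} (hp : p ≠ 0) (hk : k ≠ 0) :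
    cmpRes .eq (encodeNat p) (encodeNat k) = decide (p ≤ k) := by
  obtain ⟨P, hP, rfl⟩ := exists_encodePosNum hp
  obtain ⟨K, hK, rfl⟩ := exists_encodePosNum hk
  rw [hP, hK, cmpRes_encodePosNum]
  simp only [ne_eq, reduceCtorEq, not_false_eq_true, and_true]
  rw [decide_eq_decide]; omega

/-! ### The instance: pairs and non-pairs -/

/-- `boolPair` in terms of `dbl`. [Arora–Barak 2009, §0.1] [folklore] -/
theorem boolPair_eq_dbl (x y : List Bool) : boolPair x y = SProg.dbl x ++ false :: true :: y := by
  simp [boolPair, SProg.dbl]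

/-- `dbl` is a monoid morphism. [folklore] -/
theorem dbl_append (x y : List Bool) : SProg.dbl (x ++ y) = SProg.dbl x ++ SProg.dbl y := by
  simp [SProg.dbl]

/-- Every bit string is a doubled string followed by a tail that is empty, a single bit, or
starts with an unequal pair. [folklore] -/
theorem exists_dbl_append (x : List Bool) :
    ∃ a t, x = SProg.dbl a ++ t ∧ (t = [] ∨ (∃ e, t = [e]) ∨ (∃ r, t = false :: true :: r) ∨
      ∃ r, t = true :: false :: r) := by
  induction x using List.twoStepInduction with
  | nil => exact ⟨[], [], rfl, Or.inl rfl⟩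
  | singleton e => exact ⟨[], [e], rfl, Or.inr (Or.inl ⟨e, rfl⟩)⟩
  | cons_cons e e' r ih _ =>
    by_cases h : e = e'
    · subst h
      obtain ⟨a, t, hr, ht⟩ := ih
      exact ⟨e :: a, t, by simp [hr], ht⟩
    · refine ⟨[], e :: e' :: r, rfl, Or.inr (Or.inr ?_)⟩
      cases e <;> cases e' <;> simp_all

/-- Strings whose doubled prefix is not followed by the separator `01` are not pairs.
[Arora–Barak 2009, §0.1] [folklore] -/
theorem dbl_append_ne_boolPair (a t : List Bool)
    (ht : t = [] ∨ (∃ e, t = [e]) ∨ ∃ r, t = true :: false :: r) (a' b' : List Bool) :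
    SProg.dbl a ++ t ≠ boolPair a' b' := by
  rw [boolPair_eq_dbl]
  induction a generalizing a' with
  | nil =>
    cases a' with
    | nil => rcases ht with rfl | ⟨e, rfl⟩ | ⟨r, rfl⟩ <;> simp
    | cons c a' => rcases ht with rfl | ⟨e, rfl⟩ | ⟨r, rfl⟩ <;> cases c <;> simp
  | cons c a ih =>
    cases a' with
    | nil => cases c <;> simp
    | cons c' a' =>
      simp only [SProg.dbl_cons, List.cons_append, ne_eq, List.cons.injEq, not_and]
      intro _ _
      exact ih a'

/-- The membership bit of a pair: both components canonical numerals, and the arithmetic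
answer. [Arora–Barak 2009, Example 2.3] [folklore] -/
theorem factBit_boolPair (a b : List Bool) :
    factBit (boolPair a b) = (decide (encodeNat (decodeNat a) = a ∧ encodeNat (decodeNat b) = b) &&
      factAnswer (decodeNat a) (decodeNat b) (decodeNat a).primeFactorsList) := by
  have hinj : ∀ p q : List Bool, boolPair p q = boolPair a b ↔ p = a ∧ q = b := fun p q =>
    ⟨fun h => Prod.mk.inj (boolPair_injective (a₁ := (p, q)) (a₂ := (a, b)) h), fun ⟨h₁, h₂⟩ => by rw [h₁, h₂]⟩
  simp [factBit, natPairEncoding, Encoding.pairBool, encodingNatBool, boolUnpair_boolPair, hinj]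

/-- The membership bit of a non-pair is `false`. [Arora–Barak 2009, Example 2.3] [folklore] -/
theorem factBit_eq_false {x : List Bool} (h : ∀ a b, x ≠ boolPair a b) : factBit x = false := by
  simp only [factBit, natPairEncoding, Encoding.pairBool, encodingNatBool, Option.pure_def,
    Option.bind_eq_bind, Option.bind_some, Bool.and_eq_false_imp, decide_eq_true_eq]
  intro hx
  exact absurd hx.symm (h _ _)

/-! ### The factor list -/

/-- The code of the empty list is the separator. [Arora–Barak 2009, §0.1] [folklore] -/
theorem encode_list_nil (w : List Bool) : encodingListNatBool.encode [] ++ w = false :: true :: w := rfl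

/-- The code of a nonempty list: unary length, separator, first entry doubled, separator, rest.
[Arora–Barak 2009, §0.1] [folklore] -/
theorem encode_list_cons (p : ℕ) (L : List ℕ) (w : List Bool) :
    ∃ rest, encodingListNatBool.encode (p :: L) ++ w =
      true :: true :: (SProg.dbl (List.replicate L.length true) ++ false :: true ::
        (SProg.dbl (encodeNat p) ++ false :: true :: rest)) := by
  refine ⟨List.foldr (fun a acc => boolPair (encodeNat a) acc) [] L ++ w, ?_⟩
  simp [encodingListNatBool, Encoding.listBool, unaryEncodeNat_eq_replicate, boolPair_eq_dbl,
    List.replicate_succ, encodingNatBool]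

/-! ### The complete run -/

/-- `Halts c B v`: from `c`, within `B` steps, the machine halts with output register `[v]`.
[folklore] -/
def Halts (c : SCfg 4) (B : ℕ) (v : Bool) : Prop :=
  ∃ t ≤ B, ∃ k₁ k₂ i, prog.step^[t] c = C 63 [v] k₁ k₂ i

/-- Prepending an exact run. [folklore] -/
theorem Halts.of_run {c c' : SCfg 4} {t B : ℕ} {v : Bool} (h' : Halts c' B v)
    (h : prog.step^[t] c = c') : Halts c (B + t) v := by
  obtain ⟨t', ht', k₁, k₂, i, h''⟩ := h'
  exact ⟨t' + t, by omega, k₁, k₂, i, by rw [Function.iterate_add_apply, h, h'']⟩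

/-- Weakening the bound. [folklore] -/
theorem Halts.mono {c : SCfg 4} {B B' : ℕ} {v : Bool} (h : Halts c B v) (hB : B ≤ B') :
    Halts c B' v := by
  obtain ⟨t, ht, k₁, k₂, i, h⟩ := h
  exact ⟨t, ht.trans hB, k₁, k₂, i, h⟩

/-- From the final address. [folklore] -/
theorem halts_fin (v : Bool) (k₁ k₂ i : List Bool) : Halts (C (fin v) [] k₁ k₂ i) 2 v := by
  obtain ⟨t, ht, h⟩ := run_fin v [] k₁ k₂ i
  exact ⟨t, ht, k₁, k₂, i, h⟩

/-- From the rejecting address. [folklore] -/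
theorem halts_rej (k₁ k₂ i : List Bool) : Halts (C 62 [] k₁ k₂ i) 2 false :=
  halts_fin false k₁ k₂ i

/-- `decodeNat [] = 0`. [folklore] -/
theorem decodeNat_nil : decodeNat [] = 0 := by simp [decodeNat, decodeNum]

/-- A string whose last bit is `0` is not a canonical numeral. [folklore] -/
theorem not_canon_of_reverse {b l : List Bool} (hb : b.reverse = false :: l) :
    encodeNat (decodeNat b) ≠ b := by
  intro h
  have hb' : b = l.reverse ++ [false] := by simpa using congrArg List.reverse hb
  exact encodeNat_ne_append_false _ _ (h.trans hb')

/-- A string whose last bit is `1`, from its reverse. [folklore] -/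
theorem eq_of_reverse_true {b l : List Bool} (hb : b.reverse = true :: l) :
    b = l.reverse ++ [true] := by
  simpa using congrArg List.reverse hb

/-- Strings ending in `1` decode to positive numbers. [folklore] -/
theorem decodeNat_append_true_ne_zero (l : List Bool) : decodeNat (l ++ [true]) ≠ 0 := by
  rw [← bitsToNat_eq_decodeNat]
  have := two_pow_le_bitsToNat l
  have : 0 < 2 ^ l.length := Nat.two_pow_pos _
  omega

/-- Strings of length `≥ 2` ending in `1` decode to numbers `≥ 2`. [folklore] -/
theorem two_le_decodeNat (l : List Bool) (d : Bool) : 2 ≤ decodeNat (l ++ [d] ++ [true]) := by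
  rw [← bitsToNat_eq_decodeNat]
  have h1 := two_pow_le_bitsToNat (l ++ [d])
  have h2 : 2 ≤ 2 ^ (l ++ [d]).length := by
    rw [List.length_append, List.length_singleton, pow_succ]
    linarith [Nat.one_le_two_pow (n := l.length)]
  exact h2.trans h1

/-- In a nonempty prime factor list the head is the least element. [folklore] -/
theorem head_le_of_mem_primeFactorsList {N p₁ p : ℕ} {L : List ℕ}
    (hL : N.primeFactorsList = p₁ :: L) (hp : p ∈ N.primeFactorsList) : p₁ ≤ p := by
  have hN : N ≠ 0 := by rintro rfl; simp at hL
  obtain ⟨m, rfl⟩ : ∃ m, N = m + 2 := by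
    rcases N with _ | _ | m
    · exact absurd rfl hN
    · simp at hL
    · exact ⟨m, rfl⟩
  rw [Nat.primeFactorsList_add_two] at hL
  obtain ⟨rfl, -⟩ := List.cons.inj hL
  obtain ⟨hpp, hpd⟩ := (Nat.mem_primeFactorsList hN).1 hp
  exact Nat.minFac_le_of_dvd hpp.two_le hpd

/-- **The run of the post-processor.** On `⟨x, y⟩` with `y` extending the code of the prime
factor list of `decodeNat (boolUnpair x).1`, the machine halts within `4 |⟨x, y⟩| + 18` steps
with output register `[factBit x]`. [Arora–Barak 2009, Example 2.3 (search vs decision)]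
[folklore] -/
theorem halts_main (x w : List Bool) :
    Halts (C 0 [] [] [] (boolPair x
      (encodingListNatBool.encode (decodeNat (boolUnpair x).1).primeFactorsList ++ w)))
      (4 * (boolPair x
        (encodingListNatBool.encode (decodeNat (boolUnpair x).1).primeFactorsList ++ w)).length + 18)
      (factBit x) := by
  set y := encodingListNatBool.encode (decodeNat (boolUnpair x).1).primeFactorsList ++ w with hy
  obtain ⟨a, t, rfl, ht⟩ := exists_dbl_append x
  have hlen : (boolPair (SProg.dbl a ++ t) y).length =
      4 * a.length + 2 * t.length + 2 + y.length := by
    simp only [length_boolPair, List.length_append, SProg.length_dbl]; ring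
  have hz : boolPair (SProg.dbl a ++ t) y =
      SProg.dbl (SProg.dbl a) ++ (SProg.dbl t ++ false :: true :: y) := by
    rw [boolPair_eq_dbl, dbl_append, List.append_assoc]
  rw [hlen, hz]
  have h1 := run_quads a [] [] [] (SProg.dbl t ++ false :: true :: y)
  rw [List.append_nil] at h1
  rcases ht with rfl | ⟨e, rfl⟩ | ⟨b, rfl⟩ | ⟨r, rfl⟩
  · -- no separator: `x = dbl a` is not a pair
    rw [factBit_eq_false (dbl_append_ne_boolPair a [] (Or.inl rfl))]
    rw [SProg.dbl_nil, List.nil_append] at h1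
    have H := (halts_rej [] a.reverse y).of_run (run_bad_nil [] [] a.reverse y)
    have H := H.of_run h1
    exact H.mono (by simp only [List.length_nil]; omega)
  · -- a single trailing bit: not a pair
    rw [factBit_eq_false (dbl_append_ne_boolPair a [e] (Or.inr (Or.inl ⟨e, rfl⟩)))]
    cases e
    · rw [SProg.dbl_cons, SProg.dbl_nil, List.cons_append, List.cons_append, List.nil_append] at h1
      have H := (halts_rej [] a.reverse y).of_run (run_bad_f [] [] a.reverse y)
      have H := H.of_run h1
      exact H.mono (by simp only [List.length_cons, List.length_nil]; omega)
    · rw [SProg.dbl_cons, SProg.dbl_nil, List.cons_append, List.cons_append, List.nil_append] at h1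
      have H := (halts_rej [] a.reverse (true :: y)).of_run (run_bad_tt [] [] a.reverse (true :: y))
      have H := H.of_run h1
      exact H.mono (by simp only [List.length_cons, List.length_nil]; omega)
  · -- `x = boolPair a b`
    have hx : SProg.dbl a ++ false :: true :: b = boolPair a b := (boolPair_eq_dbl a b).symm
    simp only [hx, boolUnpair_boolPair] at hy
    rw [hx, factBit_boolPair]
    have e1 : SProg.dbl (false :: true :: b) ++ false :: true :: y =
        false :: false :: true :: true :: (SProg.dbl b ++ false :: true :: y) := by simp
    rw [e1] at h1 ⊢
    rcases ha : a.reverse with _ | ⟨c, ar⟩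
    · -- `a = []`, `N = 0`
      have ha' : a = [] := List.reverse_eq_nil_iff.mp ha
      subst ha'
      rw [ha] at h1
      have h2 := run_sep_nil [] [] (SProg.dbl b ++ false :: true :: y)
      have h3 := run_pairsA0 b [] [] [] (false :: true :: y)
      rw [List.append_nil] at h3
      have h4 := run_endA0 [] b.reverse [] y
      obtain ⟨t5, ht5, k₁', h5⟩ := run_testA0 [] b.reverse [] y
      have hpre : ∀ v : Bool, (decide (encodeNat (decodeNat []) = [] ∧ encodeNat (decodeNat b) = b) &&
          factAnswer (decodeNat []) (decodeNat b) (decodeNat []).primeFactorsList) = v ↔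
          (decide (encodeNat (decodeNat b) = b) && decide (2 ≤ decodeNat b)) = v := by
        intro v
        rw [decodeNat_nil, Nat.primeFactorsList_zero]
        simp [factAnswer, show encodeNat 0 = [] from rfl]
      have key : (decide (encodeNat (decodeNat []) = [] ∧ encodeNat (decodeNat b) = b) &&
          factAnswer (decodeNat []) (decodeNat b) (decodeNat []).primeFactorsList) =
          (match b.reverse with | true :: _ :: _ => true | _ => false) := by
        rw [hpre]
        rcases hb : b.reverse with _ | ⟨d, _ | ⟨d', l⟩⟩
        · rw [List.reverse_eq_nil_iff.mp hb]; decide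
        · cases d
          · simp [not_canon_of_reverse hb]
          · have hb' : b = [true] := by simpa using congrArg List.reverse hb
            subst hb'; decide
        · cases d
          · simp [not_canon_of_reverse hb]
          · have hb' : b = (l.reverse ++ [d']) ++ [true] := by
              simpa [List.append_assoc] using congrArg List.reverse hb
            rw [hb', encodeNat_decodeNat_append_true]
            simp only [decide_true, Bool.true_and]
            exact decide_eq_true (two_le_decodeNat _ _)
      rw [key]
      have H := (halts_fin _ k₁' [] y).of_run h5
      have H := H.of_run h4
      have H := H.of_run h3
      have H := H.of_run h2
      have H := H.of_run h1
      exact H.mono (by simp only [List.length_cons, List.length_nil]; omega)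
    · rw [ha] at h1
      have har : ar.length + 1 = a.length := by
        rw [← List.length_reverse (as := a), ha, List.length_cons]
      cases c
      · -- `a` ends in `0`: not a canonical numeral
        rw [show decide (encodeNat (decodeNat a) = a ∧ encodeNat (decodeNat b) = b) = false from
          decide_eq_false fun h => not_canon_of_reverse ha h.1, Bool.false_and]
        have h2 := run_sep_false [] [] ar (SProg.dbl b ++ false :: true :: y)
        have H := (halts_rej [] ar (SProg.dbl b ++ false :: true :: y)).of_run h2
        have H := H.of_run h1
        exact H.mono (by simp only [List.length_cons]; omega)
      · -- `a` ends in `1`: canonical, `N ≥ 1`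
        have ha' : a = ar.reverse ++ [true] := eq_of_reverse_true ha
        have hca : encodeNat (decodeNat a) = a := by
          rw [ha']; exact encodeNat_decodeNat_append_true _
        have hN : decodeNat a ≠ 0 := by rw [ha']; exact decodeNat_append_true_ne_zero _
        have h2 := run_sep_true [] [] ar (SProg.dbl b ++ false :: true :: y)
        have h3 := run_clr ar [] [] (SProg.dbl b ++ false :: true :: y)
        have h4 := run_pairsA1 b [] [] [] (false :: true :: y)
        rw [List.append_nil] at h4
        have h5 := run_endA1 [] b.reverse [] y
        simp only [hca, true_and, factAnswer, hN, if_false]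
        by_cases hb : ∃ l, b.reverse = true :: l
        · obtain ⟨l, hb⟩ := hb
          have hb' : b = l.reverse ++ [true] := eq_of_reverse_true hb
          have hcb : encodeNat (decodeNat b) = b := by
            rw [hb']; exact encodeNat_decodeNat_append_true _
          have hk : decodeNat b ≠ 0 := by rw [hb']; exact decodeNat_append_true_ne_zero _
          have hbl : l.length + 1 = b.length := by rw [hb']; simp
          have h6 := run_testA1 [] l [] y
          rw [← hb] at h6
          have h7 := run_rev b.reverse [] [] y
          rw [List.reverse_reverse, List.append_nil, List.length_reverse] at h7
          simp only [hcb, decide_true, Bool.true_and]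
          -- the factor list
          rcases hL : (decodeNat a).primeFactorsList with _ | ⟨p₁, L⟩
          · -- no prime factors (`N = 1`)
            have hy' : y = false :: true :: w := by rw [hy, hL]; rfl
            simp only [List.not_mem_nil, false_and, exists_false, decide_false]
            have h8 : prog.step^[1] (C 37 [] [] b y) = C 62 [] [] b (true :: w) := by
              rw [hy']; exact run_hdr_nil [] [] b (true :: w)
            have H := (halts_rej [] b (true :: w)).of_run h8
            have H := H.of_run h7
            have H := H.of_run h6
            have H := H.of_run h5
            have H := H.of_run h4
            have H := H.of_run h3
            have H := H.of_run h2
            have H := H.of_run h1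
            exact H.mono (by simp only [List.length_cons]; omega)
          · obtain ⟨rest, hy'⟩ := encode_list_cons p₁ L w
            have hy'' : y = true :: true :: (SProg.dbl (List.replicate L.length true) ++ false :: true ::
                (SProg.dbl (encodeNat p₁) ++ false :: true :: rest)) := by rw [hy, hL]; exact hy'
            have hp₁ : p₁ ≠ 0 :=
              (Nat.prime_of_mem_primeFactorsList (n := decodeNat a) (by rw [hL]; simp)).ne_zero
            have hans : decide (∃ p ∈ p₁ :: L, p ≤ decodeNat b) = decide (p₁ ≤ decodeNat b) := by
              rw [decide_eq_decide]
              refine ⟨?_, fun h => ⟨p₁, by simp, h⟩⟩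
              rintro ⟨p, hp, hpk⟩
              exact (head_le_of_mem_primeFactorsList hL (hL ▸ hp)).trans hpk
            rw [hans, ← cmpRes_encodeNat hp₁ hk, hcb]
            have hylen := congrArg List.length hy''
            simp only [List.length_cons, List.length_append, SProg.length_dbl,
              List.length_replicate] at hylen
            have h8 : prog.step^[2] (C 37 [] [] b y) = C 39 [] [] b (SProg.dbl (List.replicate L.length true) ++
                false :: true :: (SProg.dbl (encodeNat p₁) ++ false :: true :: rest)) := by
              rw [hy'']; exact run_hdr_first [] [] b _
            have h9 := run_hdr_rest L.length [] [] b (false :: true ::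
              (SProg.dbl (encodeNat p₁) ++ false :: true :: rest))
            have h10 := run_hdr_end [] [] b (SProg.dbl (encodeNat p₁) ++ false :: true :: rest)
            obtain ⟨t11, ht11, kb', i', h11⟩ := run_cmp (encodeNat p₁) .eq [] [] b rest
            have H := (halts_fin (cmpRes .eq (encodeNat p₁) b) [] kb' i').of_run h11
            have H := H.of_run h10
            have H := H.of_run h9
            have H := H.of_run h8
            have H := H.of_run h7
            have H := H.of_run h6
            have H := H.of_run h5
            have H := H.of_run h4
            have H := H.of_run h3
            have H := H.of_run h2
            have H := H.of_run h1
            refine H.mono ?_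
            simp only [List.length_cons]
            omega
        · -- `b` empty (`k = 0`) or ending in `0` (not canonical): reject
          push Not at hb
          obtain ⟨k₁', h6⟩ := run_testA1_rej [] [] y b.reverse hb
          have key : (decide (encodeNat (decodeNat b) = b) &&
              decide (∃ p ∈ (decodeNat a).primeFactorsList, p ≤ decodeNat b)) = false := by
            rcases hb' : b.reverse with _ | ⟨d, l⟩
            · rw [List.reverse_eq_nil_iff.mp hb', decodeNat_nil]
              simp only [Bool.and_eq_false_imp, decide_eq_true_eq, decide_eq_false_iff_not,
                not_exists, not_and, Nat.le_zero]
              rintro - p hp rfl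
              exact (Nat.prime_of_mem_primeFactorsList hp).ne_zero rfl
            · cases d
              · rw [show decide (encodeNat (decodeNat b) = b) = false from
                  decide_eq_false (not_canon_of_reverse hb'), Bool.false_and]
              · exact absurd hb' (hb l)
          rw [key]
          have H := (halts_rej k₁' [] y).of_run h6
          have H := H.of_run h5
          have H := H.of_run h4
          have H := H.of_run h3
          have H := H.of_run h2
          have H := H.of_run h1
          exact H.mono (by simp only [List.length_cons]; omega)
  · -- an unequal pair `10` before any separator: not a pair
    rw [factBit_eq_false (dbl_append_ne_boolPair a _ (Or.inr (Or.inr ⟨r, rfl⟩)))]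
    have e1 : SProg.dbl (true :: false :: r) ++ false :: true :: y =
        true :: true :: false :: (false :: (SProg.dbl r ++ false :: true :: y)) := by simp
    rw [e1] at h1 ⊢
    have H := (halts_rej [] a.reverse (false :: (SProg.dbl r ++ false :: true :: y))).of_run
      (run_bad_tt [] [] a.reverse _)
    have H := H.of_run h1
    exact H.mono (by simp only [List.length_cons]; omega)

/-! ### The post-processor as a string function -/

/-- The clock polynomial `3n + 20` (the run takes at most `4|z| + 18` steps; the framework
adds `|z|`). [folklore] -/
noncomputable def clock : Polynomial ℕ := 3 * Polynomial.X + 20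

/-- Evaluating the clock. [folklore] -/
@[simp] theorem clock_eval (n : ℕ) : clock.eval n = 3 * n + 20 := by simp [clock]

/-- **The post-processor** `postFn`: the output register of `prog` after `|z| + 3|z| + 20`
steps from the initial configuration on `z`. [folklore] -/
noncomputable def postFn (z : List Bool) : List Bool :=
  (prog.step^[z.length + clock.eval z.length] (SProg.init z)).regs 0

/-- The post-processor is polynomial-time computable (`SProg.outputFn_mem_FP`).
[Minsky 1967, §11.1, §14.1; Arora–Barak 2009, §1.3–1.4] [folklore] -/
theorem postFn_mem_FP : postFn ∈ FP :=
  prog.outputFn_mem_FP 0 clock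

/-- **Specification of the post-processor.** On `⟨x, y⟩` where `y` extends the code of the
prime factor list of `decodeNat (boolUnpair x).1` — the promise delivered by Shor's algorithm run
on the first component of `x` — the output is the membership bit `[x ∈ FACT]`.
[Arora–Barak 2009, Example 2.3 (search vs decision for factoring)] [folklore] -/
theorem postFn_spec (x w : List Bool) :
    postFn (boolPair x
      (encodingListNatBool.encode (decodeNat (boolUnpair x).1).primeFactorsList ++ w)) =
      [factBit x] := by
  obtain ⟨t, ht, k₁, k₂, i, h⟩ := halts_main x w
  unfold postFn
  set z := boolPair x (encodingListNatBool.encode (decodeNat (boolUnpair x).1).primeFactorsList ++ w)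
  rw [init_eq, clock_eval,
    show z.length + (3 * z.length + 20) = (z.length + (3 * z.length + 20) - t) + t by omega,
    Function.iterate_add_apply, h, run_halt]
  rfl

end FactPost

/-! ### Assembly: `FACT ∈ BQP` from the classical wrap and Shor's theorem -/

/-- **`FACT ∈ BQP` from two named facts.** Given the closure of bounded-error quantum search
under `FP` pre- and post-processing (`isQSolvable_classicalWrap`) and Shor's factoring theorem in
FBQP form (`isQSolvable_factoring`), `FACT ∈ BQP`: pre-process the instance to its first
component (`boolUnpairFst_mem_FP`), run Shor's family, post-process with `FactPost.postFn`
(`postFn_mem_FP`, `postFn_spec`), and read wire `0` (`mem_BQP_of_isQSolvable_bit`, with the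
discharged unitarity facts `QCircuit.outputPMF_apply_holds`, `cliffordT_isUnitary_holds`).
[cite: Shor1997, §5 (factoring in BQP, decision form)] -/
theorem FACT_mem_BQP_of_wrap (hwrap : isQSolvable_classicalWrap)
    (hShor : isQSolvable_factoring) : FACT_mem_BQP := by
  have h1 := hwrap (fun z => (boolUnpair z).1) FactPost.postFn boolUnpairFst_mem_FP
    FactPost.postFn_mem_FP hShor
  have h2 : IsQSolvable fun x => {z | [factBit x] <+: z} := by
    refine h1.mono fun x z hz => ?_
    obtain ⟨y, hy, hz⟩ := hz
    obtain ⟨w, rfl⟩ := hy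
    rw [FactPost.postFn_spec] at hz
    exact hz
  exact mem_BQP_of_isQSolvable_bit (fun n m => QCircuit.outputPMF_apply_holds)
    cliffordT_isUnitary_holds factBit_eq_true_iff h2

end Literature.Computability.Cryptography
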